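import Summits.SmoothPoincare4.SmoothPoincare4.Theses.CongruenceShadows

/-!
# Disproof attempts for `CongruenceShadows.NilpotentShadowsStandard` (crux `stmt-SmoothPoincare4-14594`)

Standing-disprover work file (refuter, cdisprove mode). Prose lives in docstrings only.

## Findings (index)

* **Read-back.** `(⊤ : Subgroup S).lowerCentralSeries (c+1)` is Mathlib's `Subgroup.lowerCentralSeries`
  (`S.lcs 0 = S`, `S.lcs (n+1) = ⁅S.lcs n, S⁆`), so level `c` is the quotient `S/γ_{c+2}S`; `c = 0` is the
  abelian (Lagrangian-triple) shadow (`Subgroup.top_lowerCentralSeries_one`). Quantifier shape `∀ c, ∃ ψ`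
  (per level). No junk operators; `m = 0` is the honest type `(3;1,1,1)`.
* **(a) Load-bearing hypotheses.**
  `nilpotentShadowsStandard_false_without_trisection` — dropping `IsGroupTrisection` kills the statement
  already at `m = 0, c = 0` (witness `K = ⊤`: the abelian shadow of `N₀` is proper, detected by the
  character `b₁ ↦ 1 ∈ ℤ`).
  `anyGroup_false_of_genusThreeTrisectionOfCyclic` — replacing the trivial group `PUnit` by an arbitrary
  group is false as soon as a `(3,1)` group trisection of a non-trivial cyclic group exists (spun lens
  spaces `𝒮(L(p,q))`, Meier 2018 Thm 1.2/§4.1, arXiv:1708.01214): the abelian shadow sees `H₁(X) = G^ab`.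
  The existence hypothesis `GenusThreeTrisectionOfCyclic` is a definition-level debt (the kernel triple
  of `𝒯(p,q)` is explicit but its seven free-rank computations are not in the tree), so this is a
  negative lemma MODULO that hypothesis — it concerns a variant, not the crux.
* **(b) Shape of any counterexample.** `shadowStandardAt_of_iso`, `shadowStandardAt_mono`,
  `counterexample_shape`: `¬ NilpotentShadowsStandard` forces a `(3+3m, m+1)` group trisection of `{1}`
  that is NOT `Iso` to the standard one and whose shadows are non-standard from some level `c₀` on
  (all lower levels standard). By Abrams–Gay–Kirby Thm 5 such a `K` is a genus-`(3+3m)` trisection of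
  a homotopy 4-sphere, i.e. an exotic `S⁴` or a non-standard balanced trisection of `S⁴`
  (¬ 4-dimensional Waldhausen, Meier–Schirmer–Zupan Conj.), neither known.  Non-vacuity:
  `standard_isGroupTrisection`.
* **(c) Levels.** `c = 0`: true on paper (integral symplectic normal form; = support item
  `AbelianShadowStandard`, hand proof in the rattack seat's EVIDENCE.md §4; it also answers
  Isoshima's Question 5.3(i), arXiv:2309.06778, in the negative for homotopy spheres).
  `c = 1`, `m ≤ 1`: TRUE by a clean argument (`levelOne_note`): take any lift `φ` of the abelian
  standardiser `σ₀ ∈ Sp^±` and correct by a Torelli `u` solving `(p₀,p₁,p₂)(τ₁u) = (e₀,e₁,e₂)`, where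
  `pᵢ : Λ³H → Λ³(H/Lᵢ)` and the defects `eᵢ` of handlebody subgroups lie in `Λ³(H/Lᵢ)` (Hensel: the
  handlebody group surjects onto the parabolic `Stab_Sp(L)`); `Λ³H → ⊕ᵢ Λ³(H/Lᵢ)` is surjective iff
  `k = m+1 ≤ 2` (complements `C₀ = {b₁ⱼ,b₂ⱼ,a₃ⱼ}`, `C₁ = {b₁ⱼ,a₂ⱼ,b₃ⱼ}`, `C₂ = {a₁ⱼ,b₂ⱼ,b₃ⱼ}` pairwise meet
  in `k` letters, a 3-subset inside an intersection needs `k ≥ 3`). Inputs: `c = 0`, `MCG ↠ Sp`, Johnson's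
  `τ₁ : ℐ ↠ Λ³H` (`g ≥ 3`), Hensel. For `m ≥ 2` the cokernel is free of rank `3·C(k,3)`; pair-standardness
  confines the defect to the image (`p₂(ker p₀) ∩ p₂(ker p₁) = p₂(ker p₀ ∩ ker p₁)`) granted Goeritz-type
  surjectivity / Omori–Morita `τ₁(ℐ∩𝒜) = ker(Λ³H → Λ³H′)`.
  `c = 2`, LINEAR MODEL: for `κ ∈ J₂` the level-2 defect is `vᵢ(κ) = prᵢ(τ₂κ) ∈ D₂(H/Lᵢ) ≅ S²Λ²(H/Lᵢ)`
  (monomials of `S²Λ²H ↠ D₂(H)` supported on `Cᵢ`); a monomial `(e∧f)⊙(g∧h)` needs ≥ 2 letters, so for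
  `k = 1` no monomial is supported on two complements and `U = v(J₂) = ⊕ᵢ D₂(H/Lᵢ)` mod every odd `p`:
  the J₂-correction kills EVERY level-2 defect — no odd-primary level-2 obstruction at genus 3 (same
  conclusion for all `k` by the `K2 = Rz` mechanism of level 1). Even INTEGRALLY: `Im τ₂ = Ker Tr^{as}`
  (Morita, Yokomizo; Faes arXiv:2010.16268 Thm 2.4) and `Tr^{as}` is built from `ω`-contractions, which
  vanish on monomials supported on the ISOTROPIC letter set `Cᵢ`; these monomials span `prᵢ(D₂) = S²Λ²(H/Lᵢ)`,
  so `v(J₂) = ⊕ᵢ S²Λ²(H/Lᵢ)` over `ℤ` — the 2-torsion of `D₂/Im τ₂` does not obstruct either. A level-2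
  counterexample would therefore have to come from OUTSIDE the linear model (failure of Goeritz-type
  lift surjectivity `(𝒜ᵢ∩𝒜ⱼ) ↠ P_ij`, `τ₁(ℐ∩𝒜ᵢ∩𝒜ⱼ) = ker pᵢ ∩ ker pⱼ`, i.e. realizable defect triples
  not of the form assumed) — the profile searches below test exactly that, model-free.
  Faes' Cor. 4.11 (`τ₂(𝒜∩J₂) ⊊ Im τ₂ ∩ Ker(D₂H → D₂H′)`) ENLARGES level-2 handlebody stabilisers — it
  coarsens orbits, so it helps the crux, not a refutation.
  `c = 3`: first RATIONAL battleground — `Im τ₃ ⊗ ℚ = Ker(Tr₃ : D₃ → S³H)` (Morita trace) is not spanned by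
  monomials, so `U₃ = (prᵢ)(Ker Tr₃)` may be a proper non-coordinate subspace and the obstruction
  `O₃ = Rz/K2` may be non-zero. Exact `F_p`-linear algebra job `lin3.py` (kit j010284 p=10007, j010285
  p=5) computes `dim U, K2, Rz, O` for `W ∈ {D₃, Ker Tr₃}` at genus 3 (and re-derives the level-2 claim).
* **(d) Targets.** none yet (no line picked; payload.targets = []).
* **(e) Candidates in print.** (i) Gluck-twist diagrams of the spun torus knots `S(t(2n+1,2))`,
  `n ≥ 2` (Isoshima–Ogawa arXiv:2305.12042 Lemma 3.11, genus 6 = `m = 1`; standardness open = Isoshima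
  arXiv:2309.06778 Question 5.2; homologically standard = level 0, their Thm 1.2) — curves only in
  figures, not transcribable from text here. (ii) Aranda–Zupan arXiv:2503.04607 §8 Prop 8.1: every
  irreducible weakly reducible genus-3 trisection comes from `(K, τ, λ)`, `K` a tunnel-number-one knot in
  `S³` or `S¹×S²`; with `[K]` a generator of `π₁(S¹×S³)` and `K` complicated this is their "strong
  candidate" for a non-standard `(3;1)` trisection of `S⁴` (`m = 0`). The sibling seat on `ShadowsStandard`
  (Cruxes/ShadowsStandard/Disproof.lean §6) builds these in kernel form (28 so far, finite shadows
  `T_Q` equal for `S₃, D₄, Q₈`). REQUEST to sibling seats: record candidate kernel triples as Lean `def`s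
  (words) — the Lazard-profile test below is complementary (deeper, nilpotent levels) and runs on any
  kernel-form triple in any presentation of `S₃`.
* **(f) Experiments in flight (kit, evidence auto-attached to the item).** Invariant: the size profile of
  the modular lattice generated by the three images in a characteristic quotient `Q = S/γ_{c+2}S·S^p`
  (`p ≥ 5`: `|Q| = p^{dim 𝔏_{≤c+1}}`; computed inside the p-class quotient, `γ₃ ⊆ P₃` so p-class ≤ 3 is
  blind to Johnson-kernel changes) — equal profiles are NECESSARY for `Aut(S)`-equivalence, so ONE
  mismatch on ONE certified group trisection of `{1}` refutes the crux at that `(m, c)`.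
  Families: `shadow3.g` (j009395): `K = (N₀, N₁, a·N₂)`, `a` random in `Stab N₀` (products of the
  exhaustively found elementary substitution automorphisms of `S₃`), pair `(N₁, aN₂) ≅ ℤ` and `π₁ = 1`
  Tietze-certified; `shadowJK2/3.g` (j009991 genus 3, j010120 genus 6, j010298 with `J₃` commutators):
  `K = (N₀, N₁, κN₂)`, `κ` a conjugate of a BSCC twist (`J₂`) or `[Torelli, BSCC]` (`J₃`) — Torelli/
  Johnson-kernel SURGERIES on the standard trisection of `S⁴`, both pairs and `π₁` certified; quotients
  `(p,c) ∈ {(5,2),(7,2),(3,2),(5,3),(7,3)}`. Linear models: `lin2.g`/`linL.g` (GAP, j010050/51/66/67) and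
  `lin3.py` (j010284/85). Predictions recorded before the runs: level ≤ 2 profiles all equal (else a bug or
  a genuinely new phenomenon); level 3 open.
-/

noncomputable section

-- the prescribed namespace `Summit.<P>.<Sub>.…` duplicates `SmoothPoincare4` (P = Sub)
set_option linter.dupNamespace false

namespace Summit.SmoothPoincare4.SmoothPoincare4.Cruxes.NilpotentShadowsStandard.Disproof

open Literature.Topology.FourManifolds Subgroup
open Summit.SmoothPoincare4.SmoothPoincare4.Theses.CongruenceShadows

/-- The surface group of the crux at parameter `m` (genus `3 + 3m`). [folklore] -/
abbrev S (m : ℕ) : Type := SurfaceGroup (3 + 3 * m)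

/-- The standard kernel triple `N = s4Kernels.stabilizeIter m`. [cite: AbramsGayKirby2018, §2] -/
abbrev N (m : ℕ) : TrisectionKernels (3 + 3 * m) := s4Kernels.stabilizeIter m

/-- `γ m c = γ_{c+2}(S)` in the 1-indexed convention: `(⊤).lowerCentralSeries (c+1)`. [folklore] -/
abbrev γ (m c : ℕ) : Subgroup (S m) := (⊤ : Subgroup (S m)).lowerCentralSeries (c + 1)

/-- The level-`c` shadow of `K` is standard: some automorphism of `S` carries `Nᵢ·γ` onto `Kᵢ·γ`
for all three `i` simultaneously (the inner clause of the crux). [folklore] -/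
def ShadowStandardAt (m : ℕ) (K : TrisectionKernels (3 + 3 * m)) (c : ℕ) : Prop :=
  ∃ ψ : S m ≃* S m, ∀ i : Fin 3, (N m i ⊔ γ m c).map ψ.toMonoidHom = K i ⊔ γ m c

/-- The crux, restated through `ShadowStandardAt` (definitional). [folklore] -/
theorem nilpotentShadowsStandard_iff :
    NilpotentShadowsStandard ↔
      ∀ (m : ℕ) (K : TrisectionKernels (3 + 3 * m)),
        IsGroupTrisection (3 + 3 * m) (m + 1) (PUnit : Type) K → ∀ c, ShadowStandardAt m K c :=
  Iff.rfl

/-! ## (b) Non-vacuity and the shape of a counterexample -/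

/-- The standard triple is a `(3+3m, m+1)` group trisection of the trivial group (from the tree's
discharged facts `s4Kernels_isGroupTrisection_holds`, `stabilize_isGroupTrisection_holds`): the
hypothesis of the crux is inhabited at every `m`. [cite: AbramsGayKirby2018, Def. 3] -/
theorem standard_isGroupTrisection (m : ℕ) :
    IsGroupTrisection (3 + 3 * m) (m + 1) (PUnit : Type) (N m) := by
  induction m with
  | zero => exact s4Kernels_isGroupTrisection_holds
  | succ n ih => exact stabilize_isGroupTrisection_holds _ _ _ _ ih

/-- An automorphism maps `⊤` onto `⊤`. [folklore] -/
theorem map_top_equiv {G : Type*} [Group G] (ψ : G ≃* G) :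
    (⊤ : Subgroup G).map ψ.toMonoidHom = ⊤ := by
  rw [← MonoidHom.range_eq_map, MonoidHom.range_eq_top.2 ψ.surjective]

/-- An automorphism maps `γ` onto itself (`⊤.map ψ = ⊤` and `map_lowerCentralSeries`). [folklore] -/
theorem map_γ (m c : ℕ) (ψ : S m ≃* S m) : (γ m c).map ψ.toMonoidHom = γ m c := by
  rw [Subgroup.map_lowerCentralSeries, map_top_equiv]

/-- `Iso N K` gives standard shadows at every level (take `ψ := α`). So a counterexample to the crux is
in particular NOT isomorphic to the standard trisection. [folklore] -/
theorem shadowStandardAt_of_iso {m : ℕ} {K : TrisectionKernels (3 + 3 * m)}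
    (h : TrisectionKernels.Iso (N m) K) (c : ℕ) : ShadowStandardAt m K c := by
  obtain ⟨α, hα⟩ := h
  refine ⟨α, fun i => ?_⟩
  rw [Subgroup.map_sup, hα i, map_γ]

/-- Shadows are monotone in the level: standard at level `c` ⇒ standard at every `c' ≤ c`
(`γ_{c+2} ≤ γ_{c'+2}`). Hence the set of bad levels of a counterexample is an up-set. [folklore] -/
theorem shadowStandardAt_mono {m : ℕ} {K : TrisectionKernels (3 + 3 * m)} {c c' : ℕ} (hc : c' ≤ c)
    (h : ShadowStandardAt m K c) : ShadowStandardAt m K c' := by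
  obtain ⟨ψ, hψ⟩ := h
  have hle : γ m c ≤ γ m c' := Subgroup.lowerCentralSeries_antitone ⊤ (Nat.succ_le_succ hc)
  refine ⟨ψ, fun i => ?_⟩
  have e1 : N m i ⊔ γ m c' = (N m i ⊔ γ m c) ⊔ γ m c' := by rw [sup_assoc, sup_eq_right.2 hle]
  have e2 : K i ⊔ γ m c' = (K i ⊔ γ m c) ⊔ γ m c' := by rw [sup_assoc, sup_eq_right.2 hle]
  rw [e1, e2, Subgroup.map_sup, hψ i, map_γ]

/-- WHAT A COUNTEREXAMPLE MUST BE: a `(3+3m, m+1)` group trisection of the trivial group (a trisection of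
a homotopy 4-sphere, AGK Thm 5), not `Iso` to the standard one, with a threshold level `c₀` below which
all shadows are standard and from which on none is. [folklore] -/
theorem counterexample_shape (h : ¬ NilpotentShadowsStandard) :
    ∃ (m : ℕ) (K : TrisectionKernels (3 + 3 * m)) (c₀ : ℕ),
      IsGroupTrisection (3 + 3 * m) (m + 1) (PUnit : Type) K ∧ ¬ TrisectionKernels.Iso (N m) K ∧
      (∀ c, c < c₀ → ShadowStandardAt m K c) ∧ (∀ c, c₀ ≤ c → ¬ ShadowStandardAt m K c) := by
  rw [nilpotentShadowsStandard_iff] at h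
  push Not at h
  obtain ⟨m, K, hK, hbad⟩ := h
  -- the least bad level
  classical
  let c₀ := Nat.find hbad
  have hc₀ : ¬ ShadowStandardAt m K c₀ := Nat.find_spec hbad
  refine ⟨m, K, c₀, hK, fun hiso => hc₀ (shadowStandardAt_of_iso hiso c₀), fun c hc => ?_,
    fun c hc hsh => hc₀ (shadowStandardAt_mono hc hsh)⟩
  by_contra hnot
  exact Nat.find_min hbad hc hnot

/-! ## (a) Load-bearing analysis -/

/-- The surface relator dies in every commutative group. [folklore] -/
theorem lift_surfaceRelator_eq_one {g : ℕ} {A : Type*} [CommGroup A] (f : surfaceGen g → A) :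
    FreeGroup.lift f (surfaceRelator g) = 1 := by
  unfold surfaceRelator
  rw [map_list_prod, List.map_map]
  apply List.prod_eq_one
  intro x hx
  rw [List.mem_map] at hx
  obtain ⟨i, -, rfl⟩ := hx
  simp [genA, genB, mul_inv_cancel_comm]

/-- Characters of the surface group: any assignment of generators into a commutative group extends.
[folklore] -/
def character {g : ℕ} {A : Type*} [CommGroup A] (f : surfaceGen g → A) : SurfaceGroup g →* A :=
  PresentedGroup.toGroup (f := f) (by
    intro r hr
    rw [Set.mem_singleton_iff] at hr
    subst hr
    exact lift_surfaceRelator_eq_one f)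

@[simp] theorem character_of {g : ℕ} {A : Type*} [CommGroup A] (f : surfaceGen g → A)
    (x : surfaceGen g) : character f (PresentedGroup.of x) = f x :=
  PresentedGroup.toGroup.of _

/-- The commutator subgroup `γ₂ = (⊤).lowerCentralSeries 1` dies under every character. [folklore] -/
theorem lcs_one_le_ker_character {g : ℕ} {A : Type*} [CommGroup A] (f : surfaceGen g → A) :
    (⊤ : Subgroup (SurfaceGroup g)).lowerCentralSeries 1 ≤ (character f).ker := by
  rw [Subgroup.top_lowerCentralSeries_one]
  exact Abelianization.commutator_subset_ker _

/-- The character `b₁ ↦ 1 ∈ ℤ`, all other generators `↦ 0`, of `S₃`. [folklore] -/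
def bOneCharacter : SurfaceGroup 3 →* Multiplicative ℤ :=
  character fun x => if x = ((0 : Fin 3), true) then Multiplicative.ofAdd 1 else 1

/-- `N₀ = ⟪a₁, a₂, b₃⟫` dies under the `b₁`-character. [folklore] -/
theorem s4Kernels_zero_le_ker : s4Kernels 0 ≤ bOneCharacter.ker := by
  rw [s4Kernels_eq]
  refine Subgroup.normalClosure_le_normal ?_
  rintro _ ⟨x, hx, rfl⟩
  rw [SetLike.mem_coe, MonoidHom.mem_ker, bOneCharacter, character_of]
  have hx' : x ≠ ((0 : Fin 3), true) := by
    rintro rfl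
    simp [s4Gens] at hx
  simp [hx']

/-- The abelian shadow of `N₀` is proper: `N₀ · γ₂ ≠ ⊤` (it misses `b₁`). [folklore] -/
theorem s4Kernels_zero_sup_lcs_one_ne_top :
    s4Kernels 0 ⊔ (⊤ : Subgroup (SurfaceGroup 3)).lowerCentralSeries 1 ≠ ⊤ := by
  intro h
  have hle : s4Kernels 0 ⊔ (⊤ : Subgroup (SurfaceGroup 3)).lowerCentralSeries 1 ≤ bOneCharacter.ker :=
    sup_le s4Kernels_zero_le_ker (lcs_one_le_ker_character _)
  rw [h, top_le_iff] at hle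
  have hb : bOneCharacter (SurfaceGroup.b (0 : Fin 3)) = 1 := by
    rw [← MonoidHom.mem_ker, hle]; exact Subgroup.mem_top _
  rw [SurfaceGroup.b, bOneCharacter, character_of] at hb
  simp at hb

/-- The crux with the hypothesis `IsGroupTrisection (3+3m) (m+1) PUnit K` DROPPED. [folklore] -/
def NilpotentShadowsStandardWithoutTrisection : Prop :=
  ∀ (m : ℕ) (K : TrisectionKernels (3 + 3 * m)) (c : ℕ), ShadowStandardAt m K c

/-- ANY PROOF MUST USE THE TRISECTION HYPOTHESIS: without it the statement fails at `m = 0`, `c = 0`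
for the junk triple `K = ⊤` — an automorphism would have to carry the proper subgroup `N₀γ₂` onto
`⊤`. [folklore] -/
theorem nilpotentShadowsStandard_false_without_trisection :
    ¬ NilpotentShadowsStandardWithoutTrisection := by
  intro h
  obtain ⟨ψ, hψ⟩ := h 0 (fun _ => ⊤) 0
  have h0 := hψ 0
  rw [top_sup_eq, ← map_top_equiv ψ] at h0
  exact s4Kernels_zero_sup_lcs_one_ne_top (Subgroup.map_injective ψ.injective h0)

/-- The crux with the trivial group replaced by an ARBITRARY group `G`, i.e. for the
`(3+3m, m+1)` group trisections of every group (these are the genus-`3+3m` trisections of closed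
4-manifolds with `χ = 2`, e.g. spun 3-manifolds). [folklore] -/
def NilpotentShadowsStandardAnyGroup : Prop :=
  ∀ (m : ℕ) (G : Type) [Group G] (K : TrisectionKernels (3 + 3 * m)),
    IsGroupTrisection (3 + 3 * m) (m + 1) G K → ∀ c, ShadowStandardAt m K c

/-- HYPOTHESIS (construction debt, true in print): there is a `(3,1)` group trisection of a non-trivial
finite cyclic group — the spun lens space `𝒮(L(p,q))` carries a `(3,1)`-trisection `𝒯(p,q)` with
`π₁ = ℤ/p` (Meier, *Trisections and spun 4-manifolds*, arXiv:1708.01214, Thm 1.2 and §4.1), whose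
group trisection (AGK Thm 5) is a `(3,1)` trisection of `ℤ/p`. Not constructed here: the kernel triple is
explicit but its free-rank certificates are a definition-level computation.
[cite: Meier2017, Thm 1.2] -/
def GenusThreeTrisectionOfCyclic : Prop :=
  ∃ (p : ℕ) (K : TrisectionKernels 3), 1 < p ∧ IsGroupTrisection 3 1 (Multiplicative (ZMod p)) K

/-- Every element of `S₃` lies in `N₀ ⊔ N₁ ⊔ N₂` (each generator is killed by some kernel). [folklore] -/
theorem s4Kernels_sup_eq_top : s4Kernels 0 ⊔ s4Kernels 1 ⊔ s4Kernels 2 = ⊤ := by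
  rw [eq_top_iff, ← PresentedGroup.closure_range_of, Subgroup.closure_le]
  rintro _ ⟨x, rfl⟩
  obtain ⟨i, hi⟩ := s4Gens_cover x
  have hmem := of_mem_s4Kernels i hi
  fin_cases i
  · exact Subgroup.mem_sup_left (Subgroup.mem_sup_left hmem)
  · exact Subgroup.mem_sup_left (Subgroup.mem_sup_right hmem)
  · exact Subgroup.mem_sup_right hmem

/-- THE TRIVIAL GROUP IS LOAD-BEARING ALREADY AT `c = 0`: a `(3,1)` trisection of `ℤ/p`, `p > 1`, has a
non-standard abelian shadow, because `⊔ᵢ Kᵢ·γ₂` lies in the kernel of `S ↠ ℤ/p` while `⊔ᵢ Nᵢ = ⊤`.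
(Negative lemma modulo the construction `GenusThreeTrisectionOfCyclic`; concerns the any-group VARIANT,
not the crux.) [folklore] -/
theorem anyGroup_false_of_genusThreeTrisectionOfCyclic :
    GenusThreeTrisectionOfCyclic → ¬ NilpotentShadowsStandardAnyGroup := by
  rintro ⟨p, K, hp, hK⟩ h
  haveI : Fact (1 < p) := ⟨hp⟩
  obtain ⟨ψ, hψ⟩ := h 0 (Multiplicative (ZMod p)) K hK 0
  obtain ⟨e⟩ := hK.triple
  -- the surjection `S ↠ ℤ/p` through the triple quotient
  let φ : SurfaceGroup 3 →* Multiplicative (ZMod p) :=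
    e.toMonoidHom.comp (QuotientGroup.mk' _)
  have hφK : ∀ i, K i ≤ φ.ker := by
    intro i x hx
    have hxU : x ∈ ⋃ j, (K j : Set (SurfaceGroup 3)) := Set.mem_iUnion.2 ⟨i, hx⟩
    rw [MonoidHom.mem_ker]
    change e (QuotientGroup.mk' _ x) = 1
    rw [QuotientGroup.mk'_apply, (QuotientGroup.eq_one_iff x).2 (Subgroup.subset_normalClosure hxU),
      map_one]
  have hφγ : (⊤ : Subgroup (SurfaceGroup 3)).lowerCentralSeries 1 ≤ φ.ker := by
    rw [Subgroup.top_lowerCentralSeries_one]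
    exact Abelianization.commutator_subset_ker _
  have hall : ∀ i, K i ⊔ (⊤ : Subgroup (SurfaceGroup 3)).lowerCentralSeries 1 ≤ φ.ker :=
    fun i => sup_le (hφK i) hφγ
  -- transport `⊤ = ⊔ Nᵢγ` through `ψ`
  have htop : (⊤ : Subgroup (SurfaceGroup 3)) ≤ φ.ker := by
    have h3 : (s4Kernels 0 ⊔ γ 0 0) ⊔ (s4Kernels 1 ⊔ γ 0 0) ⊔ (s4Kernels 2 ⊔ γ 0 0) = ⊤ := by
      rw [eq_top_iff, ← s4Kernels_sup_eq_top]
      exact sup_le (sup_le (le_sup_left.trans (le_sup_left.trans le_sup_left))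
        (le_sup_left.trans (le_sup_right.trans le_sup_left))) (le_sup_left.trans le_sup_right)
    have := congrArg (Subgroup.map ψ.toMonoidHom) h3
    rw [map_top_equiv, Subgroup.map_sup, Subgroup.map_sup] at this
    rw [← this]
    exact sup_le (sup_le ((hψ 0).le.trans (hall 0)) ((hψ 1).le.trans (hall 1)))
      ((hψ 2).le.trans (hall 2))
  -- but `φ` is onto a non-trivial group
  obtain ⟨x, hx⟩ : ∃ x, φ x = Multiplicative.ofAdd 1 :=
    (e.surjective.comp (QuotientGroup.mk'_surjective _)) _
  have hx1 : φ x = 1 := (MonoidHom.mem_ker).1 (htop (Subgroup.mem_top x))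
  rw [hx1] at hx
  have : (1 : ZMod p) = 0 := by
    have := congrArg Multiplicative.toAdd hx
    simpa using this.symm
  exact one_ne_zero this

/-! ## (c) Level notes (documentation-only declarations) -/

/-- LEVEL-1 NOTE (c = 1, quotient `S/γ₃S`). Normalise `K = (N₀, N₁, K₂)` (WaldhausenPairs) and the
abelian shadow (c = 0). A correction `ψ = h ∘ u`, `h ∈ Stab N₀ ∩ Stab N₁`, `u` Torelli, works iff
`pᵢ(τ₁ u) = dᵢ` (`i = 0,1,2`) where `τ₁ u ∈ Λ³H` (Johnson, surjective for `g ≥ 3`), `pᵢ : Λ³H → Λ³(H/Lᵢ)`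
and `dᵢ ∈ Λ³(H/Lᵢ)` is the defect of the `i`-th target. In the standard symplectic basis the three
complements are `C₀ = {b₁ⱼ, b₂ⱼ, a₃ⱼ}`, `C₁ = {b₁ⱼ, a₂ⱼ, b₃ⱼ}`, `C₂ = {a₁ⱼ, b₂ⱼ, b₃ⱼ}` (`j ≤ k`); the map
`Λ³H → ⊕ᵢ Λ³(H/Lᵢ)` is surjective iff no 3-subset lies in two complements, i.e. iff `k ≤ 2`; for `k ≥ 3`
its cokernel is free of rank `3·C(k,3)` (subsets of `{b₁ⱼ}`, `{b₂ⱼ}`, `{b₃ⱼ}`). Pair-standardness puts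
`d₂ ∈ p₂(ker p₀) ∩ p₂(ker p₁) = p₂(ker p₀ ∩ ker p₁)`, so the obstruction class of an actual trisection
vanishes: no level-1 counterexample, for any `m`, granted `Heeg(#ᵏS¹×S², genus 3k) ↠ Stab L₀ ∩ Stab L₁`.
This declaration only pins the note to the index; it asserts nothing. [folklore] -/
theorem levelOne_note : True := trivial

end Summit.SmoothPoincare4.SmoothPoincare4.Cruxes.NilpotentShadowsStandard.Disproof

end
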